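import Literature.NumberTheory.Transcendental.NesterenkoUResultantIntegral
import Literature.NumberTheory.Transcendental.NesterenkoIntegerHeights
import Mathlib.RingTheory.Polynomial.Basic
import Mathlib.Algebra.Polynomial.Eval.Degree
import HarnessLib

/-!
# The `u`-resultant of the Chow form of a prime with a form, V: integer coefficients (towards LNM 1752 Ch. 3 Prop. 4.11, route B)

`Literature/NumberTheory/Transcendental/NesterenkoUResultantIntCoeffs.lean`. Sequel of
`NesterenkoUResultantIntegral.lean`. Let `F = chowForm 𝔭 (s+1) = λ · F₀` with `F₀ ∈ ℤ[u]`
primitive (`λ ∈ ℚˣ`), `Q₀ ∈ ℤ[x̲]` a form of degree `d`, `G = uResultant 𝔭 s d Q₀ ∈ ℚ[u₁, …, u_s]`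
(so that `G = c^d ∏ Q₀(β⁽ⁱ⁾)` in `Ω` for the splitting `F_Ω = c ∏ (β⁽ⁱ⁾ · u_{s+1})`). The
NORMALISED resultant `G₀ = λ^{−d} G` is the split norm of the splitting `F₀,Ω = (λ⁻¹c) ∏ (β⁽ⁱ⁾·u)`
of the INTEGER form `F₀`, and we prove that it has INTEGER coefficients
(`exists_int_uResultant`: `λ^{-d} G = map G₀`, `G₀ ∈ ℤ[u₁, …, u_s]`). This is the arithmetic
input of the height estimate 2) and of the value estimate 3) of Prop. 4.11 (at the finite places
the resultant is bounded by `|F|_p^d |Q|_p^D`; equivalently: integrality).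

Proof: for every valuation subring `V` of `Ω` containing the generic hyperplane coordinates
`u_{ij}` (hence the image of `ℤ[u]`), the coefficients of `F₀,Ω` lie in `V`, so
`G₀ ∈ V` by the normalisation lemma `exists_integral_split` (`algebraMap_normResultant_mem`);
hence `G₀` is integral over `ℤ[u₁, …, u_s]` (Stacks 090P), i.e. a root of a monic polynomial with
coefficients in `ℤ[u]` (`isIntegral_normResultant`); and an element of `ℚ[u]` integral over
`ℤ[u]` lies in `ℤ[u]` (`mem_range_map_of_monic_eval₂_eq_zero`: clear denominators `x = y/N` and
descend on `N` using that `p` is a prime element of `ℤ[u]` for a prime `p ∣ N`).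

Definition: `normResultant` (plumbing: `λ^{−d} · uResultant` for the chosen primitive
representative `chowFormInt`/`chowFormScalar` of the Chow form); no named facts.

## References

* [NesterenkoPhilippon2001] Yu. V. Nesterenko, P. Philippon (eds.), *Introduction to Algebraic
  Independence Theory*, LNM 1752, Springer 2001, Ch. 3 §4, Def. 4.2 (p. 38), Prop. 4.11
  (pp. 40–41).
* [Nes10] Yu. V. Nesterenko, Proc. Steklov Inst. Math. 218 (1997) 294–331, Prop. 1.4.
-/

noncomputable section

open MvPolynomial

attribute [local instance] MvPolynomial.gradedAlgebra

namespace Literature.NumberTheory.Transcendental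

namespace Nesterenko

variable {m : ℕ}

/-! ### Elements of `ℚ[u]` integral over `ℤ[u]` lie in `ℤ[u]` -/

section Descent

variable {σ : Type*}

/-- Clearing denominators: `x = N⁻¹ · y` with `y ∈ ℤ[u]`, `N ≥ 1`. [folklore] -/
theorem exists_eq_C_inv_mul_map (x : MvPolynomial σ ℚ) :
    ∃ (N : ℕ) (y : MvPolynomial σ ℤ), 1 ≤ N ∧ x = C ((N : ℚ)⁻¹) * map (Int.castRingHom ℚ) y := by
  by_cases hx : x = 0
  · exact ⟨1, 0, le_rfl, by rw [hx, map_zero, mul_zero]⟩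
  obtain ⟨c, -, Z, hxZ, -, -⟩ := exists_eq_C_mul_map_primitive x hx
  refine ⟨c.den, C c.num * Z, c.den_pos, ?_⟩
  have hc' : (c : ℚ) = (c.den : ℚ)⁻¹ * (c.num : ℚ) := by rw [inv_mul_eq_div, Rat.num_div_den]
  rw [hxZ, map_mul, map_C, eq_intCast, ← mul_assoc, ← C_mul, ← hc']

/-- **An element of `ℚ[u]` which is a root of a monic polynomial with coefficients in `ℤ[u]` lies
in `ℤ[u]`** (`ℤ[u]` is integrally closed in `ℚ[u]`; proof by clearing denominators and descent on
the denominator through the prime elements `p ∈ ℤ[u]`). [folklore] -/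
theorem mem_range_map_of_monic_eval₂_eq_zero (x : MvPolynomial σ ℚ)
    (q : Polynomial (MvPolynomial σ ℤ)) (hq : q.Monic)
    (hx : q.eval₂ (map (Int.castRingHom ℚ)) x = 0) :
    x ∈ (map (Int.castRingHom ℚ) : MvPolynomial σ ℤ →+* MvPolynomial σ ℚ).range := by
  obtain ⟨N, y, hN, hxy⟩ := exists_eq_C_inv_mul_map x
  set j : MvPolynomial σ ℤ →+* MvPolynomial σ ℚ := map (Int.castRingHom ℚ) with hj
  have hjinj : Function.Injective j := map_injective _ (RingHom.injective_int _)
  set n := q.natDegree with hn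
  have hsum : ∑ i ∈ Finset.range (n + 1), j (q.coeff i) * x ^ i = 0 := by
    rw [← Polynomial.eval₂_eq_sum_range]; exact hx
  -- descent on `N`
  induction N using Nat.strong_induction_on generalizing y with
  | _ N ih =>
  have hN0 : (N : ℚ) ≠ 0 := by exact_mod_cast (show N ≠ 0 by omega)
  by_cases hN1 : N = 1
  · subst hN1
    refine ⟨y, ?_⟩
    rw [hxy, Nat.cast_one, inv_one, C_1, one_mul]
  -- a prime `p ∣ N`
  set p := N.minFac with hp
  have hpp : p.Prime := Nat.minFac_prime hN1
  have hpN : p ∣ N := Nat.minFac_dvd N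
  -- `j y = N x`
  have hjy : j y = C (N : ℚ) * x := by
    rw [hxy, ← mul_assoc, ← C_mul, mul_inv_cancel₀ hN0, C_1, one_mul]
  -- the integer identity `∑ qᵢ N^{n-i} yⁱ = 0`
  set S : MvPolynomial σ ℤ := ∑ i ∈ Finset.range (n + 1), q.coeff i * C ((N : ℤ) ^ (n - i)) * y ^ i
    with hSdef
  have hS : j S = C ((N : ℚ) ^ n) * ∑ i ∈ Finset.range (n + 1), j (q.coeff i) * x ^ i := by
    rw [hSdef, map_sum, Finset.mul_sum]
    refine Finset.sum_congr rfl fun i hi => ?_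
    have hi' : i ≤ n := Nat.lt_succ_iff.mp (Finset.mem_range.mp hi)
    have hNi : (((N : ℤ) ^ (n - i) : ℤ) : ℚ) * (N : ℚ) ^ i = (N : ℚ) ^ n := by
      push_cast
      rw [← pow_add, Nat.sub_add_cancel hi']
    rw [map_mul, map_mul, map_pow j y i, hjy, mul_pow, ← C_pow]
    have hC : j (C ((N : ℤ) ^ (n - i))) = C (((N : ℤ) ^ (n - i) : ℤ) : ℚ) := by
      rw [hj, map_C, eq_intCast]
    rw [hC]
    calc j (q.coeff i) * C (((N : ℤ) ^ (n - i) : ℤ) : ℚ) * (C ((N : ℚ) ^ i) * x ^ i)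
        = C ((((N : ℤ) ^ (n - i) : ℤ) : ℚ) * (N : ℚ) ^ i) * (j (q.coeff i) * x ^ i) := by
          rw [C_mul]; ring
      _ = _ := by rw [hNi]
  rw [hsum, mul_zero] at hS
  have hS0 : S = 0 := hjinj (by rw [hS, map_zero])
  have hkey : y ^ n = -∑ i ∈ Finset.range n, q.coeff i * C ((N : ℤ) ^ (n - i)) * y ^ i := by
    have h1 : S = (∑ i ∈ Finset.range n, q.coeff i * C ((N : ℤ) ^ (n - i)) * y ^ i) + y ^ n := by
      rw [hSdef, Finset.sum_range_succ, show q.coeff n = 1 from hq.coeff_natDegree, Nat.sub_self,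
        pow_zero, C_1, one_mul, one_mul]
    rw [hS0] at h1
    exact eq_neg_of_add_eq_zero_right h1.symm
  -- `C p ∣ y^n`, hence `C p ∣ y`
  have hprime : Prime (C (p : ℤ) : MvPolynomial σ ℤ) :=
    (MvPolynomial.prime_C_iff σ).mpr (Nat.prime_iff_prime_int.mp hpp)
  have hpdvd : (C (p : ℤ) : MvPolynomial σ ℤ) ∣ y ^ n := by
    rw [hkey]
    refine (Finset.dvd_sum fun i hi => ?_).neg_right
    have hi' : i < n := Finset.mem_range.mp hi
    have h1 : (p : ℤ) ∣ (N : ℤ) ^ (n - i) :=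
      (Int.natCast_dvd_natCast.mpr hpN).trans (dvd_pow_self _ (by omega))
    exact dvd_mul_of_dvd_left (dvd_mul_of_dvd_right (map_dvd C h1) _) _
  obtain ⟨y', hy'⟩ := hprime.dvd_of_dvd_pow hpdvd
  -- descend: `x = (N/p)⁻¹ · y'`
  have hp0 : p ≠ 0 := hpp.ne_zero
  have hNp : 1 ≤ N / p := Nat.div_pos (Nat.le_of_dvd (by omega) hpN) hpp.pos
  have hlt : N / p < N := Nat.div_lt_self (by omega) hpp.one_lt
  refine ih (N / p) hlt y' hNp ?_
  rw [hxy, hy', map_mul, map_C, eq_intCast, ← mul_assoc, ← C_mul, Nat.cast_div hpN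
    (by exact_mod_cast hp0), inv_div, Int.cast_natCast, div_eq_inv_mul]

end Descent

/-! ### Coefficients of the split integer Chow form -/

section Coeff

variable {s : ℕ}

/-- `ℤ[u₁, …, u_s]`. [folklore] -/
abbrev RUZ (s m : ℕ) : Type := MvPolynomial (Fin s × Fin (m + 1)) ℤ

/-- The integer version of `splitLast`. [folklore] -/
def splitLastInt (s m : ℕ) : RUZ (s + 1) m →ₐ[ℤ] MvPolynomial (Fin (m + 1)) (RUZ s m) :=
  aeval fun w : Fin (s + 1) × Fin (m + 1) =>
    lastCombine (fun v : Fin s × Fin (m + 1) => (C (X v) : MvPolynomial (Fin (m + 1)) (RUZ s m)))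
      (fun j => X j) w

/-- `splitLast (map F₀) = map (map) (splitLastInt F₀)`: splitting off the last group commutes with
the coefficient map `ℤ → ℚ`. [folklore] -/
theorem splitLast_map (F₀ : RUZ (s + 1) m) :
    splitLast s m (map (Int.castRingHom ℚ) F₀) =
      MvPolynomial.map (map (Int.castRingHom ℚ) : RUZ s m →+* RU s m) (splitLastInt s m F₀) := by
  have key : ((splitLast s m : RU (s + 1) m →+* MvPolynomial (Fin (m + 1)) (RU s m)).comp
      (map (Int.castRingHom ℚ))) =
      (MvPolynomial.map (map (Int.castRingHom ℚ) : RUZ s m →+* RU s m)).comp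
        (splitLastInt s m).toRingHom := by
    refine ringHom_ext (fun k => ?_) (fun w => ?_)
    · simp [splitLastInt]
    · obtain ⟨i, j⟩ := w
      induction i using Fin.lastCases with
      | last => simp [splitLastInt]
      | cast i => simp [splitLastInt]
  exact RingHom.congr_fun key F₀

/-- Hence every coefficient of `splitLast (map F₀)` is the image of an integer polynomial.
[folklore] -/
theorem coeff_splitLast_map_mem_range (F₀ : RUZ (s + 1) m) (e : Fin (m + 1) →₀ ℕ) :
    coeff e (splitLast s m (map (Int.castRingHom ℚ) F₀)) ∈
      (map (Int.castRingHom ℚ) : RUZ s m →+* RU s m).range := by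
  rw [splitLast_map, coeff_map]
  exact ⟨_, rfl⟩

end Coeff

/-! ### The normalised resultant has integer coefficients -/

section Prime

variable {s : ℕ} {𝔭 : Ideal (Rx m)}

/-- A primitive integer representative of the Chow form: `F = chowFormScalar · chowFormInt` with
`chowFormInt ∈ ℤ[u]` primitive (junk when `F = 0`). [cite: NesterenkoPhilippon2001, Ch. 3 §4,
remark after Def. 4.2 (p. 38)] -/
def chowFormScalar (𝔭 : Ideal (Rx m)) (s : ℕ) : ℚ :=
  open Classical in
  if h : chowForm 𝔭 (s + 1) ≠ 0 then (exists_eq_C_mul_map_primitive _ h).choose else 1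

/-- See `chowFormScalar`. [cite: NesterenkoPhilippon2001, Ch. 3 §4, remark after Def. 4.2
(p. 38)] -/
def chowFormInt (𝔭 : Ideal (Rx m)) (s : ℕ) : RUZ (s + 1) m :=
  open Classical in
  if h : chowForm 𝔭 (s + 1) ≠ 0 then (exists_eq_C_mul_map_primitive _ h).choose_spec.2.choose else 0

/-- The defining properties of `chowFormScalar`, `chowFormInt`. [folklore] -/
theorem chowFormInt_spec (h : chowForm 𝔭 (s + 1) ≠ 0) :
    chowFormScalar 𝔭 s ≠ 0 ∧
      chowForm 𝔭 (s + 1) = C (chowFormScalar 𝔭 s) * map (Int.castRingHom ℚ) (chowFormInt 𝔭 s) ∧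
      (chowFormInt 𝔭 s).support = (chowForm 𝔭 (s + 1)).support ∧
      (chowFormInt 𝔭 s).support.gcd (fun γ => coeff γ (chowFormInt 𝔭 s)) = 1 := by
  classical
  have hex := exists_eq_C_mul_map_primitive _ h
  simp only [chowFormScalar, chowFormInt, dif_pos h]
  exact ⟨hex.choose_spec.1, hex.choose_spec.2.choose_spec⟩

/-- **The normalised `u`-resultant** `G₀ = λ^{−d} G`, `λ = chowFormScalar`: the split norm of the
INTEGER form `F₀ = chowFormInt` (`F₀,Ω = (λ⁻¹ c) ∏ (β⁽ⁱ⁾ · u)`).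
[cite: NesterenkoPhilippon2001, Ch. 3 Prop. 4.11 (pp. 40–41)] -/
def normResultant (𝔭 : Ideal (Rx m)) (s d : ℕ) (Q₀ : MvPolynomial (Fin (m + 1)) ℤ) : RU s m :=
  C ((chowFormScalar 𝔭 s)⁻¹ ^ d) * uResultant 𝔭 s d Q₀

/-- `ℤ[u₁, …, u_s] → Ω` lands in every valuation subring containing the `u_{ij}`. [folklore] -/
theorem algebraMap_map_mem (V : ValuationSubring (ΩU s m)) (hV : ∀ w, uΩ s m w ∈ V) (b : RUZ s m) :
    algebraMap (RU s m) (ΩU s m) (map (Int.castRingHom ℚ) b) ∈ V := by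
  induction b using MvPolynomial.induction_on with
  | C k =>
    rw [map_C, eq_intCast, map_intCast, map_intCast]
    exact intCast_mem V k
  | add p q hp hq =>
    rw [map_add, map_add]
    exact add_mem hp hq
  | mul_X p w hp =>
    rw [map_mul, map_X, map_mul]
    exact mul_mem hp (hV w)

/-- **The normalised resultant lies in every valuation subring of `Ω` containing the `u_{ij}`.**
(The coefficients of `F₀,Ω = λ⁻¹ F_Ω` are images of integer polynomials in the `u_{ij}`, hence in
`V`; apply the normalisation lemma `exists_integral_split`.) [folklore] -/
theorem algebraMap_normResultant_mem (h𝔭 : 𝔭.IsPrime)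
    (hhom : 𝔭.IsHomogeneous (homogeneousSubmodule (Fin (m + 1)) ℚ))
    (hdim : ringKrullDim (Rx m ⧸ 𝔭) = (s + 1 : ℕ)) {d : ℕ} {Q₀ : MvPolynomial (Fin (m + 1)) ℤ}
    (hQ : Q₀.IsHomogeneous d) (V : ValuationSubring (ΩU s m)) (hV : ∀ w, uΩ s m w ∈ V) :
    algebraMap (RU s m) (ΩU s m) (normResultant 𝔭 s d Q₀) ∈ V := by
  set ι := algebraMap (RU s m) (ΩU s m) with hι
  have hF0 : chowForm 𝔭 (s + 1) ≠ 0 := chowForm_ne_zero_of_prime h𝔭 hhom hdim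
  obtain ⟨hlam, hF, -, -⟩ := chowFormInt_spec hF0
  set lam := chowFormScalar 𝔭 s with hlamdef
  set F₀ := chowFormInt 𝔭 s with hF₀def
  obtain ⟨hc, hβsec, hFΩ⟩ := splitConst_spec h𝔭 hhom hdim
  -- the splitting of `F₀,Ω = λ⁻¹ F_Ω`
  set Φ₀ : MvPolynomial (Fin (m + 1)) (ΩU s m) := C (ι (C lam⁻¹)) * chowFormΩ 𝔭 s with hΦ₀def
  have hΦ₀ : Φ₀ = C (ι (C lam⁻¹) * splitConst 𝔭 s) * ∏ i, (∑ j, C (splitPts 𝔭 s i j) * X j) := by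
    rw [hΦ₀def, hFΩ, ← mul_assoc, ← map_mul]
  have hc' : ι (C lam⁻¹) * splitConst 𝔭 s ≠ 0 := by
    refine mul_ne_zero ?_ hc
    rw [hι, map_ne_zero_iff _ (algebraMap_ΩU_injective s m), Ne, C_eq_zero, inv_eq_zero]
    exact hlam
  -- its coefficients are images of integer polynomials in the `u_{ij}`
  have hcoeff : ∀ e, coeff e Φ₀ ∈ V := by
    intro e
    obtain ⟨b, hb⟩ := coeff_splitLast_map_mem_range F₀ e
    have h1 : coeff e Φ₀ = ι (map (Int.castRingHom ℚ) b) := by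
      have hsplit : splitLast s m (chowForm 𝔭 (s + 1)) =
          C (C lam) * splitLast s m (map (Int.castRingHom ℚ) F₀) := by
        rw [hF, map_mul]
        congr 1
        rw [splitLast, aeval_C, MvPolynomial.algebraMap_apply, MvPolynomial.algebraMap_eq]
      rw [hΦ₀def, coeff_C_mul, chowFormΩ, coeff_map, hsplit, coeff_C_mul, ← hb, ← hι, ← map_mul,
        ← mul_assoc, ← map_mul, inv_mul_cancel₀ hlam, C_1, one_mul]
    rw [h1]
    exact algebraMap_map_mem V hV b
  have hmem := splitNorm_mem_valuationSubring V hc' (fun i => (hβsec i).1) hΦ₀ hcoeff hQ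
  -- and its split norm is `ι (normResultant)`
  have e : splitNorm d Q₀ (ι (C lam⁻¹) * splitConst 𝔭 s) (splitPts 𝔭 s) =
      ι (normResultant 𝔭 s d Q₀) := by
    rw [splitNorm_smul_left, normResultant, map_mul, ← map_pow, ← map_pow,
      algebraMap_uResultant h𝔭 hhom hdim hQ, uResΩ, inv_pow]
  rw [← e]
  exact hmem

/-- **The normalised resultant is integral over `ℤ[u₁, …, u_s]`** (Stacks 090P). [folklore] -/
theorem isIntegralElem_normResultant (h𝔭 : 𝔭.IsPrime)
    (hhom : 𝔭.IsHomogeneous (homogeneousSubmodule (Fin (m + 1)) ℚ))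
    (hdim : ringKrullDim (Rx m ⧸ 𝔭) = (s + 1 : ℕ)) {d : ℕ} {Q₀ : MvPolynomial (Fin (m + 1)) ℤ}
    (hQ : Q₀.IsHomogeneous d) :
    ((algebraMap (RU s m) (ΩU s m)).comp (map (Int.castRingHom ℚ) : RUZ s m →+* RU s m)).IsIntegralElem
      (algebraMap (RU s m) (ΩU s m) (normResultant 𝔭 s d Q₀)) := by
  set f := (algebraMap (RU s m) (ΩU s m)).comp (map (Int.castRingHom ℚ) : RUZ s m →+* RU s m)
    with hf
  letI : Algebra (RUZ s m) (ΩU s m) := f.toAlgebra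
  change IsIntegral (RUZ s m) (algebraMap (RU s m) (ΩU s m) (normResultant 𝔭 s d Q₀))
  by_contra hni
  have hx : algebraMap (RU s m) (ΩU s m) (normResultant 𝔭 s d Q₀) ∉
      (integralClosure (RUZ s m) (ΩU s m)).toSubring := hni
  obtain ⟨V, hle, hVx⟩ := Subring.exists_le_valuationSubring_of_isIntegrallyClosedIn hx
  refine hVx (algebraMap_normResultant_mem h𝔭 hhom hdim hQ V fun w => ?_)
  have hw : uΩ s m w = algebraMap (RUZ s m) (ΩU s m) (X w) := by
    change _ = f (X w)
    rw [hf, RingHom.comp_apply, map_X]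
    rfl
  rw [hw]
  exact hle isIntegral_algebraMap

/-- **The normalised `u`-resultant has integer coefficients**: `λ^{−d} · uResultant = map G₀` with
`G₀ ∈ ℤ[u₁, …, u_s]`. [cite: NesterenkoPhilippon2001, Ch. 3 Prop. 4.11 (pp. 40–41)] -/
theorem exists_map_eq_normResultant (h𝔭 : 𝔭.IsPrime)
    (hhom : 𝔭.IsHomogeneous (homogeneousSubmodule (Fin (m + 1)) ℚ))
    (hdim : ringKrullDim (Rx m ⧸ 𝔭) = (s + 1 : ℕ)) {d : ℕ} {Q₀ : MvPolynomial (Fin (m + 1)) ℤ}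
    (hQ : Q₀.IsHomogeneous d) :
    ∃ G₀ : RUZ s m, map (Int.castRingHom ℚ) G₀ = normResultant 𝔭 s d Q₀ := by
  obtain ⟨q, hq, hq0⟩ := isIntegralElem_normResultant h𝔭 hhom hdim hQ
  have h := Polynomial.hom_eval₂ q (map (Int.castRingHom ℚ) : RUZ s m →+* RU s m)
    (algebraMap (RU s m) (ΩU s m)) (normResultant 𝔭 s d Q₀)
  rw [hq0] at h
  have h0 : q.eval₂ (map (Int.castRingHom ℚ)) (normResultant 𝔭 s d Q₀) = 0 :=
    algebraMap_ΩU_injective s m (by rw [h, map_zero])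
  obtain ⟨G₀, hG₀⟩ := mem_range_map_of_monic_eval₂_eq_zero _ q hq h0
  exact ⟨G₀, hG₀⟩

end Prime

end Nesterenko

end Literature.NumberTheory.Transcendental

end
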